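import Literature.NumberTheory.Automorphic.AutomorphicRepsGLOneHeckeCharacter
import Literature.NumberTheory.Automorphic.GLOneArchParameterClauses
import Literature.NumberTheory.Automorphic.BaseChangeArchimedeanGLOneIdentities
import Literature.NumberTheory.Automorphic.BaseChangeArchimedean
import HarnessLib

/-!
# Arthur–Clozel strong lifting at the archimedean places: the case `n = 1`

Topic `NumberTheory/Automorphic`; proof file (theorems only: no definition, no named fact, no
instance), last step of the rank-one case of the named fact
`ArthurClozel1989_strongLifting_archimedean` (`BaseChangeArchimedean`):

> J. Arthur, L. Clozel, *Simple Algebras, Base Change, and the Advanced Theory of the Trace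
> Formula*, Ann. of Math. Stud. 120 (1989), Ch. 3, Thm. 5.1 (strong lifting: a weak base-change
> lift is a strong one, in particular at the archimedean places), whose proof (p. 214) is an
> induction on `n` starting from "the case `n = 1`, which is trivial": for `GL(1)` a weak lift `Π`
> of `π` is `χ_Π = χ_π ∘ N_{E/F}` (Hecke characters), and at an archimedean place `w ∣ v` the local
> base change is `ξ ↦ ξ ∘ N_{E_w/F_v}` (Ch. 1 §6.2 for `E_w = F_v`, §7 for `ℂ/ℝ`), i.e. "restriction
> on the Weil group side" — the infinity type of `Π` at `σ : E → ℂ` is that of `π` at `σ|_F`.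

Here this is proved in the tree's honest analytic model (`AutomorphicRepData` of Borel–Jacquet on
`GL₁(𝔸)`, weak lifting `IsWeakBaseChangeLiftAE` through Satake parameters, archimedean parameters
`HasArchParameter` through the Harish-Chandra isomorphism):

* `AutomorphicRepData.hasArchParameter_of_isWeakBaseChangeLiftAE_glOne` — for automorphic
  representations `π` of `GL₁(𝔸_F)` and `Π` of `GL₁(𝔸_E)` (`E/F` Galois) with `Π` a weak
  base-change lift of `π`, every archimedean parameter `χ` of `π` restricts to one of `Π`:
  `Π` has parameter `σ ↦ χ(σ|_F)`;
* `ArthurClozel1989_strongLifting_archimedean.rank_one` — the literal `n = 1` instance of the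
  named fact (cuspidal data, `E/F` cyclic of prime degree — hypotheses not needed in rank one);
* `ArthurClozel1989_strongLifting_archimedean.hasInfinityType_baseChange_rank_one`,
  `…isLAlgebraic_baseChange_rank_one`, `…isCAlgebraic_baseChange_rank_one` — the consequences
  drawn from the fact in `BaseChangeArchimedean`, unconditionally for `GL₁`.

The proof assembles the GL(1) dictionary built for this purpose: the Hecke character `χ_π` of a
datum and `χ_Π = χ_π ∘ N_{E/F}` for a weak lift (`AutomorphicRepsGLOneHeckeCharacter`), the
archimedean parameter of a `GL₁` datum read off the real linear form `d` through which `𝔤𝔩₁(K_∞)`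
acts on the line `W/W'` and its converse (`AutomorphicRepsGLOneArchParameter`,
`GLOneArchParameterClauses`), the link `χ(det exp Y) = e^{d(Y)}`, and the place-by-place identities
between `d_Π` and `d_π` forced by `χ_Π = χ_π ∘ N` (`BaseChangeArchimedeanGLOneIdentities`:
`d_Π(r·1_w) = d_π(r·1_v)` for `w` real, `d_Π(r_w) = 2 d_π(r·1_v)` and `d_Π(ā_w) = d_Π(a_w)` for `w`
complex over `v` real, `d_Π(b_w) = d_π(b_v)` or `d_π(b̄_v)` for `w`, `v` complex), followed by the
bookkeeping of the `τ`-projectors `HCEmb.proj` defining the parameter at a complex place.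

## References

* J. Arthur, L. Clozel, Ann. of Math. Stud. 120 (1989), Ch. 1 §§6.2, 7; Ch. 3 §1 Def. 1.1, Thm. 5.1
  (p. 214, case `n = 1`) [ArthurClozelAMS120].
* A. Borel, H. Jacquet, Corvallis (1979), Part 1, §4.6 [BorelJacquet1979].
* L. Clozel, *Motifs et formes automorphes* (1990), §3.3 [Clozel1990].
-/

noncomputable section

open scoped MatrixGroups Matrix Classical ComplexConjugate
open NumberField NumberField.InfinitePlace NumberField.mixedEmbedding IsDedekindDomain

namespace Literature.NumberTheory.Automorphic

open Literature.NumberTheory.GaloisRepresentations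

/-! ### Two computations with the `τ`-projectors on `ℂ` -/

/-- If `L(i) = 0` then both projectors of `L : ℂ → ℂ` take the value `L(1)/2` at `1`. [folklore] -/
theorem HCEmb.proj_one_of_apply_I_eq_zero (L : ℂ → ℂ) (hI : L Complex.I = 0) (τ : ℂ →ₐ[ℝ] ℂ) :
    HCEmb.proj L τ 1 = 2⁻¹ * L 1 := by
  have hI' : RCLike.im (RCLike.I : ℂ) = 1 := by simp
  rw [HCEmb.proj_def, HCEmb.card_algHom_of_im_I hI']
  simp only [RCLike.I_to_complex, smul_eq_mul, mul_one, hI, mul_zero, add_zero]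
  push_cast
  ring

/-- Precomposition with complex conjugation exchanges the two projectors:
`proj (L' ∘ conj) τ 1 = proj L' (τ ∘ conj) 1` for `L'` odd at `i`. [folklore] -/
theorem HCEmb.proj_one_eq_proj_comp_conjAe (L L' : ℂ → ℂ) (hL : ∀ a, L a = L' (conj a))
    (hneg : L' (-Complex.I) = -L' Complex.I) (τ : ℂ →ₐ[ℝ] ℂ) :
    HCEmb.proj L τ 1 = HCEmb.proj L' (τ.comp (Complex.conjAe : ℂ →ₐ[ℝ] ℂ)) 1 := by
  rw [HCEmb.proj_def, HCEmb.proj_def]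
  simp only [RCLike.I_to_complex, smul_eq_mul, mul_one, AlgHom.comp_apply, AlgEquiv.coe_toAlgHom,
    Complex.conjAe_coe, Complex.conj_I, map_neg, hL, map_one, hneg]
  ring

/-! ### The rank-one case -/

section RankOne

variable {F E : Type} [Field F] [NumberField F] [Field E] [NumberField E] [Algebra F E]
  {hF : isCompact_glFiniteIntegralLevel 1 F} {hE : isCompact_glFiniteIntegralLevel 1 E}

/-- **Weak base change for `GL₁` respects archimedean parameters (Arthur–Clozel strong lifting at
infinity, case `n = 1`).** Let `E/F` be a Galois extension of number fields, `π = W/W'` an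
automorphic representation of `GL₁(𝔸_F)` and `Π` one of `GL₁(𝔸_E)` (Borel–Jacquet data) such
that `Π` is a weak base-change lift of `π` (`t_{Π,w} = t_{π,v}^{f(w|v)}` for almost all `w`). If
`π` has archimedean parameter `χ` (`χ(σ)` at `σ : F → ℂ`), then `Π` has archimedean parameter
`σ ↦ χ(σ|_F)`. (Proof: `χ_Π = χ_π ∘ N_{E/F}` and the archimedean component of `ξ ∘ N_{E_w/F_v}`.)
Arthur–Clozel (1989), Ch. 3, Thm. 5.1, p. 214 ("the case `n = 1`, which is trivial"), with Ch. 1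
§6.2 and §7. [cite: ArthurClozelAMS120, Ch. 3 Thm 5.1] -/
theorem AutomorphicRepData.hasArchParameter_of_isWeakBaseChangeLiftAE_glOne [IsGalois F E]
    (π : AutomorphicRepData (AutomorphyDatum.gl 1 F hF))
    (P : AutomorphicRepData (AutomorphyDatum.gl 1 E hE)) (hBC : IsWeakBaseChangeLiftAE π P)
    {χ : (F →+* ℂ) → Multiset ℂ} (hχ : π.HasArchParameter χ) :
    P.HasArchParameter fun τ => χ (τ.comp (algebraMap F E)) := by
  -- Hecke characters of `π` and `Π`, and `χ_Π = χ_π ∘ N`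
  obtain ⟨χπ, hχπ⟩ := π.exists_heckeCharacter_glOne
  obtain ⟨χP, hχP⟩ := P.exists_heckeCharacter_glOne
  have hbc : χP = χπ.baseChange E :=
    AutomorphicRepData.heckeCharacter_eq_baseChange_of_isWeakBaseChangeLiftAE_glOne hχπ hχP hBC
  have hinv : ∀ (σ : E ≃ₐ[F] E) (y : (AdeleRing (𝓞 E) E)ˣ), χP (σ • y) = χP y := by
    intro σ y
    rw [hbc]
    exact HeckeCharacter.baseChange_smul E χπ σ y
  have hbcv : ∀ x : (AdeleRing (𝓞 F) F)ˣ,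
      χP (AdeleRing.ideleBaseChange F E x) = χπ x ^ Fintype.card (E ≃ₐ[F] E) := by
    intro x
    rw [hbc]
    exact HeckeCharacter.baseChange_ideleBaseChange E χπ x
  -- the Lie algebra actions on the lines `W/W'`, through real linear forms
  obtain ⟨ρπ, hρπ⟩ := π.exists_hasLieAction_gl
  obtain ⟨dπ', hdπ'⟩ := π.exists_linearMap_lieAction_eq_smul_one_glOne ρπ
  obtain ⟨ρP, hρP⟩ := P.exists_hasLieAction_gl
  obtain ⟨dP', hdP'⟩ := P.exists_linearMap_lieAction_eq_smul_one_glOne ρP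
  obtain ⟨dπ, hdπ⟩ : ∃ dπ : Matrix (Fin 1) (Fin 1) (mixedSpace F) →ₗ[ℝ] ℂ,
      ∀ Y, dπ Y = dπ' ⟨Y, trivial⟩ :=
    ⟨{ toFun := fun Y => dπ' ⟨Y, trivial⟩
       map_add' := fun Y Z => map_add dπ' ⟨Y, trivial⟩ ⟨Z, trivial⟩
       map_smul' := fun c Y => map_smul dπ' c ⟨Y, trivial⟩ }, fun _ => rfl⟩
  obtain ⟨dP, hdP⟩ : ∃ dP : Matrix (Fin 1) (Fin 1) (mixedSpace E) →ₗ[ℝ] ℂ,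
      ∀ Y, dP Y = dP' ⟨Y, trivial⟩ :=
    ⟨{ toFun := fun Y => dP' ⟨Y, trivial⟩
       map_add' := fun Y Z => map_add dP' ⟨Y, trivial⟩ ⟨Z, trivial⟩
       map_smul' := fun c Y => map_smul dP' c ⟨Y, trivial⟩ }, fun _ => rfl⟩
  -- the links `χ(det (exp Y, 1)) = e^{d(Y)}`
  have hlinkπ : ∀ Y : Matrix (Fin 1) (Fin 1) (mixedSpace F),
      ((χπ (Matrix.GeneralLinearGroup.det (GLn.ofInfinite 1 F (expGL Y))) : ℂˣ) : ℂ) =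
        Complex.exp (dπ Y) := by
    intro Y
    have h := π.heckeCharacter_glOne_det_ofArch_expMem hχπ ⟨Y, trivial⟩
      (fun φ hφ => π.lieDeriv_sub_smul_mem_of_hasLieAction_glOne hρπ hdπ' ⟨Y, trivial⟩ hφ) 1
    rw [one_smul, Complex.ofReal_one, one_mul, ← hdπ] at h
    exact h
  have hlinkP : ∀ Y : Matrix (Fin 1) (Fin 1) (mixedSpace E),
      ((χP (Matrix.GeneralLinearGroup.det (GLn.ofInfinite 1 E (expGL Y))) : ℂˣ) : ℂ) =
        Complex.exp (dP Y) := by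
    intro Y
    have h := P.heckeCharacter_glOne_det_ofArch_expMem hχP ⟨Y, trivial⟩
      (fun φ hφ => P.lieDeriv_sub_smul_mem_of_hasLieAction_glOne hρP hdP' ⟨Y, trivial⟩ hφ) 1
    rw [one_smul, Complex.ofReal_one, one_mul, ← hdP] at h
    exact h
  -- the clauses of `χ`
  obtain ⟨hre, hco⟩ := π.archParameter_clauses_glOne hρπ dπ' hdπ' hχ
  refine P.hasArchParameter_glOne_of_eq_smul_one hρP dP' hdP' (fun w => ?_) (fun w τ => ?_)
  · -- a real place `w` of `E`, above the real place `v = w|_F`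
    have hv : (w.1.comap (algebraMap F E)).IsReal := w.2.comap _
    have key := dP_realPlaceLie_eq dP χP dπ χπ hlinkP hlinkπ hinv hbcv
      ⟨w.1.comap (algebraMap F E), hv⟩ w rfl 1
    rw [one_smul, hdP, hdπ] at key
    show χ (w.1.embedding.comp (algebraMap F E)) = _
    rw [← comap_embedding_of_isReal (algebraMap F E) hv, hre ⟨w.1.comap (algebraMap F E), hv⟩, key]
  · -- a complex place `w` of `E`
    show χ ((τ.toRingHom.comp w.1.embedding).comp (algebraMap F E)) = _
    rw [RingHom.comp_assoc]
    rcases (w.1.comap (algebraMap F E)).isReal_or_isComplex with hv | hv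
    · -- … above a real place `v`: `d_Π(a_w) = Re(a) · 2 d_π(1_v)`
      have hψ : w.1.embedding.comp (algebraMap F E) = (w.1.comap (algebraMap F E)).embedding :=
        (comap_embedding_of_isReal _ hv).symm
      have hτ : τ.toRingHom.comp (w.1.comap (algebraMap F E)).embedding =
          (w.1.comap (algebraMap F E)).embedding := by
        rcases Complex.real_algHom_eq_id_or_conj τ with h | h
        · rw [h]
          exact algHomId_toRingHom_comp _
        · rw [h, conjAe_toRingHom_comp]
          exact ComplexEmbedding.isReal_iff.1 (isReal_iff.1 hv)
      -- `d_Π(i_w) = 0` by conjugation invariance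
      have hI : dP (complexPlaceLie 1 w (Complex.I • (1 : Matrix (Fin 1) (Fin 1) ℂ))) = 0 := by
        have h := dP_complexPlace_conj_of_isReal_comap dP χP hlinkP hinv w hv Complex.I
        rw [Complex.conj_I, neg_smul, map_neg, map_neg] at h
        linear_combination (-(1 : ℂ) / 2) * h
      -- `d_Π(1_w) = 2 d_π(1_v)`
      have key := dP_complexPlaceLie_ofReal_eq dP χP dπ χπ hlinkP hlinkπ hinv hbcv
        ⟨w.1.comap (algebraMap F E), hv⟩ w rfl 1
      rw [Complex.ofReal_one, one_smul ℝ, hdπ] at key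
      rw [hψ, hτ, hre ⟨w.1.comap (algebraMap F E), hv⟩,
        HCEmb.proj_one_of_apply_I_eq_zero
          (fun a : ℂ => dP' ⟨complexPlaceLie 1 w (a • (1 : Matrix (Fin 1) (Fin 1) ℂ)), trivial⟩) ?_ τ]
      · refine Multiset.singleton_inj.2 ?_
        show dπ' ⟨_, trivial⟩ =
          2⁻¹ * dP' ⟨complexPlaceLie 1 w ((1 : ℂ) • (1 : Matrix (Fin 1) (Fin 1) ℂ)), trivial⟩
        rw [← hdP, key]
        ring
      · show dP' ⟨complexPlaceLie 1 w (Complex.I • (1 : Matrix (Fin 1) (Fin 1) ℂ)), trivial⟩ = 0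
        rw [← hdP]
        exact hI
    · -- … above a complex place `v`: `d_Π(b_w) = d_π(b_v)` or `d_π(b̄_v)`
      have key := dP_complexPlaceLie_eq_of_isComplex dP χP dπ χπ hlinkP hlinkπ hinv hbcv
        ⟨w.1.comap (algebraMap F E), hv⟩ w rfl
      by_cases hc : w.1.embedding.comp (algebraMap F E) = (w.1.comap (algebraMap F E)).embedding
      · -- `σ_w|_F = σ_v`: the parameters agree
        have hL : (fun a : ℂ => dP' ⟨complexPlaceLie 1 w (a • (1 : Matrix (Fin 1) (Fin 1) ℂ)), trivial⟩) =
            fun a : ℂ => dπ' ⟨complexPlaceLie 1 ⟨w.1.comap (algebraMap F E), hv⟩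
              (a • (1 : Matrix (Fin 1) (Fin 1) ℂ)), trivial⟩ := by
          funext a
          have h := key a
          rw [if_pos hc, hdP, hdπ] at h
          exact h
        rw [hc, hco ⟨w.1.comap (algebraMap F E), hv⟩ τ, hL]
      · -- `σ_w|_F = σ̄_v`: the parameters are exchanged by `τ ↦ τ ∘ conj`
        have hψ : w.1.embedding.comp (algebraMap F E) =
            (Complex.conjAe : ℂ →ₐ[ℝ] ℂ).toRingHom.comp (w.1.comap (algebraMap F E)).embedding := by
          rw [conjAe_toRingHom_comp, ← (embedding_comp_eq_or F E w.1).resolve_left hc]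
          exact (ComplexEmbedding.involutive_conjugate F _).symm
        have hcomp : τ.toRingHom.comp ((Complex.conjAe : ℂ →ₐ[ℝ] ℂ).toRingHom.comp
            (w.1.comap (algebraMap F E)).embedding) =
            (τ.comp (Complex.conjAe : ℂ →ₐ[ℝ] ℂ)).toRingHom.comp (w.1.comap (algebraMap F E)).embedding := by
          rw [← RingHom.comp_assoc]
          rfl
        have hL : ∀ a : ℂ, dP' ⟨complexPlaceLie 1 w (a • (1 : Matrix (Fin 1) (Fin 1) ℂ)), trivial⟩ =
            dπ' ⟨complexPlaceLie 1 ⟨w.1.comap (algebraMap F E), hv⟩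
              (conj a • (1 : Matrix (Fin 1) (Fin 1) ℂ)), trivial⟩ := by
          intro a
          have h := key (conj a)
          rw [if_neg hc, Complex.conj_conj, hdP, hdπ] at h
          exact h
        have hneg : dπ' ⟨complexPlaceLie 1 ⟨w.1.comap (algebraMap F E), hv⟩
              ((-Complex.I) • (1 : Matrix (Fin 1) (Fin 1) ℂ)), trivial⟩ =
            -dπ' ⟨complexPlaceLie 1 ⟨w.1.comap (algebraMap F E), hv⟩
              (Complex.I • (1 : Matrix (Fin 1) (Fin 1) ℂ)), trivial⟩ := by
          rw [← hdπ, ← hdπ, neg_smul, map_neg, map_neg]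
        rw [hψ, hcomp, hco ⟨w.1.comap (algebraMap F E), hv⟩ (τ.comp (Complex.conjAe : ℂ →ₐ[ℝ] ℂ)),
          HCEmb.proj_one_eq_proj_comp_conjAe _
            (fun a : ℂ => dπ' ⟨complexPlaceLie 1 ⟨w.1.comap (algebraMap F E), hv⟩
              (a • (1 : Matrix (Fin 1) (Fin 1) ℂ)), trivial⟩) hL hneg τ]

/-- **Arthur–Clozel strong lifting at the archimedean places, case `n = 1`** — the `n = 1`
instance of the named fact `ArthurClozel1989_strongLifting_archimedean`: for `E/F` cyclic of prime
degree and cuspidal `π` on `GL₁(𝔸_F)`, `Π` on `GL₁(𝔸_E)` with `Π` a weak base-change lift of `π`,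
every archimedean parameter of `π` restricts to one of `Π` (the cyclicity, primality and
cuspidality hypotheses of the printed theorem are not used in rank one). Arthur–Clozel (1989),
Ch. 3, Thm. 5.1, p. 214 (induction base "the case `n = 1`, which is trivial").
[cite: ArthurClozelAMS120, Ch. 3 Thm 5.1] -/
theorem ArthurClozel1989_strongLifting_archimedean.rank_one
    (F E : Type) [Field F] [NumberField F] [Field E] [NumberField E] [Algebra F E] [IsGalois F E]
    (hF : isCompact_glFiniteIntegralLevel 1 F) (hE : isCompact_glFiniteIntegralLevel 1 E)
    (_hcyc : IsCyclic (E ≃ₐ[F] E)) (_hprime : (Module.finrank F E).Prime)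
    (π : CuspidalAutomorphicRepData 1 F hF) (P : CuspidalAutomorphicRepData 1 E hE)
    (hBC : IsWeakBaseChangeLiftAE π.1 P.1)
    (χ : (F →+* ℂ) → Multiset ℂ) (hχ : π.1.HasArchParameter χ) :
    P.1.HasArchParameter fun τ => χ (τ.comp (algebraMap F E)) :=
  π.1.hasArchParameter_of_isWeakBaseChangeLiftAE_glOne P.1 hBC hχ

/-! ### The consequences of the fact, unconditionally in rank one -/

namespace ArthurClozel1989_strongLifting_archimedean

/-- **Infinity types restrict along weak base change for `GL₁`** (unconditional rank-one case of
`ArthurClozel1989_strongLifting_archimedean.hasInfinityType_baseChange`): if `T` is an infinity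
type of `π` then `T^E : τ ↦ T(τ|_F)` is one of its weak base-change lift `Π`.
[cite: ArthurClozelAMS120, Ch. 3 Thm 5.1] -/
theorem hasInfinityType_baseChange_rank_one [IsGalois F E]
    {π : AutomorphicRepData (AutomorphyDatum.gl 1 F hF)}
    {P : AutomorphicRepData (AutomorphyDatum.gl 1 E hE)} (hBC : IsWeakBaseChangeLiftAE π P)
    {T : InfinityType F 1} (hT : π.HasInfinityType T) : P.HasInfinityType (T.baseChange E) := by
  refine ⟨hT.1.baseChange, ?_⟩
  have := π.hasArchParameter_of_isWeakBaseChangeLiftAE_glOne P hBC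
    (χ := fun σ => (T σ).map ArchWeight.a) hT.2
  simpa [InfinityType.baseChange] using this

/-- **`L`-algebraicity ascends along weak base change for `GL₁`** (unconditional rank-one case of
`ArthurClozel1989_strongLifting_archimedean.isLAlgebraic_baseChange`).
[cite: ArthurClozelAMS120, Ch. 3 Thm 5.1] -/
theorem isLAlgebraic_baseChange_rank_one [IsGalois F E]
    {π : AutomorphicRepData (AutomorphyDatum.gl 1 F hF)}
    {P : AutomorphicRepData (AutomorphyDatum.gl 1 E hE)} (hBC : IsWeakBaseChangeLiftAE π P)
    (hπ : π.IsLAlgebraic) : P.IsLAlgebraic := by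
  obtain ⟨T, hT, hL⟩ := hπ
  exact ⟨T.baseChange E, hasInfinityType_baseChange_rank_one hBC hT, hL.baseChange⟩

/-- **`C`-algebraicity ascends along weak base change for `GL₁`** (unconditional rank-one case of
`ArthurClozel1989_strongLifting_archimedean.isCAlgebraic_baseChange`).
[cite: ArthurClozelAMS120, Ch. 3 Thm 5.1] -/
theorem isCAlgebraic_baseChange_rank_one [IsGalois F E]
    {π : AutomorphicRepData (AutomorphyDatum.gl 1 F hF)}
    {P : AutomorphicRepData (AutomorphyDatum.gl 1 E hE)} (hBC : IsWeakBaseChangeLiftAE π P)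
    (hπ : π.IsCAlgebraic) : P.IsCAlgebraic := by
  obtain ⟨T, hT, hC⟩ := hπ
  exact ⟨T.baseChange E, hasInfinityType_baseChange_rank_one hBC hT, hC.baseChange⟩

end ArthurClozel1989_strongLifting_archimedean

end RankOne

end Literature.NumberTheory.Automorphic
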